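import Literature.MathematicalPhysics.QuantumFieldTheory.Balaban1983to89.B9Eq365QGGQLowerVariationalWindow
import Literature.MathematicalPhysics.QuantumFieldTheory.Balaban1983to89.B9Eq319BlockPedestalLift

/-!
# `Balaban1983to89.B9Eq365QGGQLowerVariationalWindowSharp` — T. Bałaban, *Propagators for lattice gauge theories in a background field*, Commun.
# Math. Phys. **99** (1985) 389–434 [Balaban1985BackgroundPropagators] Thm 3.11 p. 416 with (3.24)–(3.25) p. 394, (3.35) p. 396, (3.65)–(3.67) p. 403,
# and [Balaban1984PropagatorsII] (2.74)–(2.77) p. 236: **THE ONE-SHOT THIRD OPERATOR `Q̃′(U)G′(U)²Q̃′(U)†` BOUNDED BELOW IN THE WINDOW BY THE PEDESTAL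
# TEST VECTOR WITH EXACT BLOCK SUMS, EVERY `L ≥ 1`** — ne9-leaf-01's windowed road (`B9Eq365QGGQLowerVariationalWindow.qggq_coercive_window`, tent,
# `3 ≤ L`) re-run at their SHARP test vector (`B9Eq365QGGQLowerVariationalSharp`, pedestal `c = L∕2`, `κ♯ = 1.4·10⁻⁴` flat): the flat energy letter becomes
# `E♯ = |η⁻¹|²·d·(L(L²+2)∕3)·(L(2L⁴+5L²+8)∕60)^{d−1}·(c₀∕c₁)`; on the diagonal at the scaled edge the floor is `κ♯₀(d, a′) = 9.7·10⁻⁷` (`d = 4`,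
# `a′ = 1`; pure-real step in this seat's `B9Eq365QGGQLowerVariationalSharpFloor.kappa_sharp_floor`) in place of the tent's `5.8·10⁻²⁰` — the one-shot
# companion of this seat's `B9Eq365QGGQLowerVariationalWindowTowerSharp` (t4-ne9-idea-1 g116 §E: «a covariant version of the SHARP (pedestal) bound is not in the tree»)

statement-level skeleton of published theorems with citation tags; proofs where landed; nothing here is a claim about the Yang–Mills mass gap

CITATION HEADER (lean-in-tree rule).  Audit cell `pub-balaban`, sub-cell `t4`, BINDER row NE9; filed by NE9 crux-team LEAF PROVER 03
(`b2b-balaban-t4-ne9-formalise-leaf-03`, gen 73).  ne9-leaf-01's `qggq_coercive_window` proof (gen 78) VERBATIM with their pedestal kit (gen 79: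
`sum_blockOf_pedestal`, `pedestal_step_le`, `sum_blockOf_pedestal_weights`, `norm_sq_covDerivL2K_lift_le_split`) in place of the tent letters; nothing
else.  Sources READ: [B9] pp. 394–396, 403, 416; [B6] p. 236 through the tree's verbatim quotations.

THE PRINT (verbatim).  [B9] p. 416 Thm 3.11: *«the operators Δ′_a, G′, (Q′G′²Q′*)⁻¹, Δ_a, G are positive definite … uniformly bounded»*; p. 403: the
averaging and projection operators at `U` *«satisfy the same bounds»* as at `U = 1`; [B6] p. 236 (2.74)–(2.77): *«γ₀ a positive, absolute constant»*.

WHAT IS PROVED (sorry-free; proof lane — 0 `def`; [folklore] Hilbert-space algebra on landed letters).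
* **`qggq_coercive_window_sharp`** — for `0 < a′`, a background with `U(b) ∈ U1`, `‖U(b) − 1‖ ≤ ε`, mutually adjoint transporters, the displayed
  positivity `hpos′` of `Δ′_{a′}(U)`, loss parameters `θ ≤ 1`, `t > 0`, and the WINDOW `ρ′·(L∕2 + L²∕4)^d ≤ θβ♯`
  (`ρ′ = (1 + 2M_φM_φ′ε)^{d(L−1)} − 1`, `β♯ = ((L²+2)∕6)^d`): `κ♯_U·‖ψ‖² ≤ re⟪ψ, Q̃′(U)G′(U)²Q̃′(U)†ψ⟫` — leaf-06's
  `B9Eq325ProjFormula.QGGQ_pos` operator VERBATIM — closed form `κ♯_U = (((1−θ)β♯)²∕M♯)²·(c₀L^d∕c₁)∕(1+ρ′)²`,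
  `M♯ = (1+t)E♯ + (1+t⁻¹)|η⁻¹|²(2M_φM_φ′ε)²·d·((L∕2+L²∕4)^d)²·(c₀L^d∕c₁) + a′(β♯ + ρ′(L∕2+L²∕4)^d)²`; NO `3 ≤ L`; `θ, t → 0` recovers leaf-01's
  flat `κ♯` in the limit of a vanishing window.
SEQUEL (staged behind oleans): the diagonal reading `κ♯₀‖ψ‖² ≤ …` with `∃ α₁ κ > 0` BEFORE `∀ L ≥ 1` through `…SharpFloor.kappa_sharp_floor`.
HONEST SCOPE.  Crude structural losses (`β∕2`, `2E + 2E′`, `(9∕4)β²`, `(3∕2)²`); `hRS`, `U1`, the edge DISPLAYED; `L²` floor only — NOT the kernel decay of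
`(Q̃′G′²Q̃′†)⁻¹`, NOT NE9 (cell pub-balaban: NE9 NOT PRINTED ∕ NOT PROVED; «NE9 ⇐ the named binders»; row WALLED ON A MODEL (O-NE9-1; #5 UNRULED); spine
PROVED 0∕9; rung (B)+1 on a finite T⁴ — NOT infinite volume, NOT mass gap, NOT BetaPertH, NOT Clay; HONEST DEPENDENCY: continuum YM on T⁴ ⇐ BetaPertH ∧ nine
spine estimates (0/9 proved); BetaPertH ⇐ (D1) ∧ (D4) ∧ CAP+tail; G-an2-4 gates asym, D1 and NE2/3/4).  NEW file importing `B9Eq365QGGQLowerVariationalWindow` and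
`B9Eq319BlockPedestalLift` (both built); nothing modified.  Net new unproved facts: 0.
-/

noncomputable section

open scoped InnerProductSpace ComplexConjugate BigOperators

namespace Literature.MathematicalPhysics.QuantumFieldTheory.Balaban1983to89.B9Eq365QGGQLowerVariationalWindowSharp

open B4Sect5Torus (TSite)
open B9SectCLatticeCarrier (Bond)
open B9Eq311L2Pairing (WL2)
open B9Eq319QprimeTorus (fineP offset offset_lt blockCoord)
open B11Eq103H1Complex (SiteL2K greenK covDerivL2K)
open B9Eq310HessianOperator (adTransportW)
open B5Eq172HodgePositivity (adTransportW_one)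
open B9Eq326OperatorAssembly (QprimeW)
open B9Eq3119DeltaPiCarrier (laplacePrimeA GpOfU)
open B9Eq325ProjFormula (laplacePrimeA_isSymmetric)
open B9Eq384RemainderLetters (norm_adTransportW_sub_le adTransportW_one_apply)
open B9Eq373DerivativeRemainderL2 (norm_covDerivL2K_sub_le)
open B9Eq319QprimeLipschitz (sum_norm_sq_QprimeW_sub_flat_le)
open B9Eq319BlockTentLift (profile_nonneg profile_le QprimeWL2_one_lift norm_sq_QprimeWL2_one_le)
open B9Eq319BlockPedestalLift (sum_pedestal_eq sum_pedestal_sq_eq sum_blockOf_pedestal pedestal_step_le sum_blockOf_pedestal_weights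
  norm_sq_covDerivL2K_lift_le_split)
open B9Eq365QGGQLowerVariational (sq_div_mul_le_re_inner_green sq_mul_norm_sq_le_re_inner_qggq)
open B9Eq365QGGQLowerVariationalWindow (re_inner_laplacePrimeA norm_sq_lift_le)

section Window

variable {d : ℕ} (L : ℕ) [NeZero L] (m : Fin d → ℕ) [∀ i, NeZero (fineP L m i)]
  {𝔸 : Type*} [NormedRing 𝔸] [NormedAlgebra ℂ 𝔸] [NormOneClass 𝔸] {W : Type*} [NormedAddCommGroup W] [InnerProductSpace ℂ W]
  [FiniteDimensional ℂ W] (φ : W ≃ₗ[ℂ] 𝔸) (c₀ : ℝ) [Fact (0 < c₀)] (η : ℝ) (c₁ : ℝ) [Fact (0 < c₁)]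

omit [∀ i, NeZero (fineP L m i)] [NormOneClass 𝔸] [FiniteDimensional ℂ W] [Fact (0 < c₀)] [Fact (0 < c₁)] in
/-- the pedestal tent is bounded by `(c + L²∕4)^d` for `0 ≤ c` (private copy of the tower file's `abs_pedestal_le`). [folklore] -/
private theorem abs_pedestal_le' {c : ℝ} (hc : 0 ≤ c) (x : TSite d (fineP L m)) :
    |∏ ν, (c + ((offset L m x ν : ℕ) : ℝ) * ((L : ℝ) - 1 - (offset L m x ν : ℕ)))| ≤ (c + (L : ℝ) ^ 2 / 4) ^ d := by
  have h0 : ∀ ν, 0 ≤ c + ((offset L m x ν : ℕ) : ℝ) * ((L : ℝ) - 1 - (offset L m x ν : ℕ)) := fun ν =>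
    add_nonneg hc (profile_nonneg (offset_lt L m x ν))
  rw [abs_of_nonneg (Finset.prod_nonneg fun ν _ => h0 ν)]
  have h := Finset.prod_le_prod (s := Finset.univ) (g := fun _ => c + (L : ℝ) ^ 2 / 4) (fun ν _ => h0 ν)
    (fun ν _ => by have := profile_le L (offset L m x ν); linarith)
  rwa [Finset.prod_const, Finset.card_univ, Fintype.card_fin] at h

omit [NeZero L] in
/-- `(a + b)² ≤ (1+t)a² + (1+t⁻¹)b²` for `t > 0` (private copy of `…SharpFloor.add_sq_le_weighted`). [folklore] -/
private theorem add_sq_le_weighted' {t : ℝ} (ht : 0 < t) (a b : ℝ) : (a + b) ^ 2 ≤ (1 + t) * a ^ 2 + (1 + t⁻¹) * b ^ 2 := by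
  have h : 2 * a * b ≤ t * a ^ 2 + t⁻¹ * b ^ 2 := by
    have h1 : 0 ≤ (t * a - b) ^ 2 := sq_nonneg _
    have h2 : t⁻¹ * (t * a - b) ^ 2 = t * a ^ 2 - 2 * a * b + t⁻¹ * b ^ 2 := by field_simp; ring
    nlinarith [mul_nonneg (inv_nonneg.2 ht.le) h1]
  nlinarith

set_option maxHeartbeats 400000 in
/-- **THE ONE-SHOT THIRD OPERATOR IN THE WINDOW BY THE PEDESTAL TEST VECTOR (`c = L∕2`), CLOSED FORM, EVERY `L ≥ 1`**: for `0 < a′`, a background with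
`U(b) ∈ U1`, `‖U(b) − 1‖ ≤ ε`, mutually adjoint transporters, the displayed positivity `hpos′` of `Δ′_{a′}(U)`, loss parameters `θ ≤ 1`, `t > 0`, and the WINDOW `ρ′·B♯ ≤ θβ♯`
(`β♯ = ((L²+2)∕6)^d`, `B♯ = (L∕2 + L²∕4)^d`, `ρ′ = (1 + 2M_φM_φ′ε)^{d(L−1)} − 1`): `κ♯_U·‖ψ‖² ≤ re⟪ψ, Q̃′(U)G′(U)²Q̃′(U)†ψ⟫` with
`κ♯_U = (((1−θ)β♯)²∕M♯)²·(c₀L^d∕c₁)∕(1+ρ′)²`, `M♯ = (1+t)E♯ + (1+t⁻¹)|η⁻¹|²(2M_φM_φ′ε)²·d·B♯²·(c₀L^d∕c₁) + a′(β♯ + ρ′B♯)²`,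
`E♯ = |η⁻¹|²·d·(L(L²+2)∕3)·(L(2L⁴+5L²+8)∕60)^{d−1}·(c₀∕c₁)` — leaf-01's `qggq_coercive_window` at their pedestal with EXACT block sums.
[cite: Balaban1985BackgroundPropagators, Thm 3.11 p.416, (3.65)–(3.67) p.403, (3.25) p.394; Balaban1984PropagatorsII, (2.74)–(2.77) p.236] -/
theorem qggq_coercive_window_sharp {a' : ℝ} (ha' : 0 < a') {Mφ Mφ' : ℝ} (hMφ : 0 ≤ Mφ) (hMφ' : 0 ≤ Mφ')
    (hφ : ∀ w, ‖φ w‖ ≤ Mφ * ‖w‖) (hφ' : ∀ X, ‖φ.symm X‖ ≤ Mφ' * ‖X‖)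
    (U : Bond d (fineP L m) → 𝔸ˣ) (hU : ∀ b, U b ∈ B7Prop1Explicit.U1 𝔸) {ε : ℝ} (hε : 0 ≤ ε) (hUε : ∀ b, ‖(U b : 𝔸) - 1‖ ≤ ε)
    (hRS : ∀ (b : Bond d (fineP L m)) (v u : W), ⟪adTransportW φ U b v, u⟫_ℂ = ⟪v, adTransportW φ (fun b => (U b)⁻¹) b u⟫_ℂ)
    (hpos' : ∀ x : SiteL2K ℂ d (fineP L m) c₀ W, x ≠ 0 → 0 < RCLike.re ⟪x, laplacePrimeA L m φ η U a' (c₁ := c₁) x⟫_ℂ)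
    {θ t : ℝ} (hθ1 : θ ≤ 1) (ht : 0 < t)
    (hwin : ((1 + 2 * Mφ * Mφ' * ε) ^ (d * (L - 1)) - 1) * ((L : ℝ) / 2 + (L : ℝ) ^ 2 / 4) ^ d ≤ θ * (((L : ℝ) ^ 2 + 2) / 6) ^ d)
    (ψ : SiteL2K ℂ d m c₁ W) :
    ((((1 - θ) * (((L : ℝ) ^ 2 + 2) / 6) ^ d) ^ 2 /
          ((1 + t) * (‖((η : ℂ))⁻¹‖ ^ 2 * ((d : ℝ) * ((L : ℝ) * ((L : ℝ) ^ 2 + 2) / 3) *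
              ((L : ℝ) * (2 * (L : ℝ) ^ 4 + 5 * (L : ℝ) ^ 2 + 8) / 60) ^ (d - 1)) * (c₀ / c₁)) +
            (1 + t⁻¹) * (‖((η : ℂ))⁻¹‖ ^ 2 * (2 * Mφ * Mφ' * ε) ^ 2 * (d : ℝ) * (((L : ℝ) / 2 + (L : ℝ) ^ 2 / 4) ^ d) ^ 2 * (c₀ * (L : ℝ) ^ d / c₁)) +
            a' * ((((L : ℝ) ^ 2 + 2) / 6) ^ d + (((1 + 2 * Mφ * Mφ' * ε) ^ (d * (L - 1)) - 1) * ((L : ℝ) / 2 + (L : ℝ) ^ 2 / 4) ^ d)) ^ 2)) ^ 2 *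
        (c₀ * (L : ℝ) ^ d / c₁) / (1 + (((1 + 2 * Mφ * Mφ' * ε) ^ (d * (L - 1)) - 1))) ^ 2) * ‖ψ‖ ^ 2 ≤
      RCLike.re ⟪ψ, (((WL2.linearEquiv ℂ ℂ (fun _ : TSite d m => c₁)).symm.toLinearMap ∘ₗ QprimeW L m φ U (c₀ := c₀)) ∘ₗ
        GpOfU L m φ η U a' (c₁ := c₁) hpos' ∘ₗ GpOfU L m φ η U a' (c₁ := c₁) hpos' ∘ₗ
        LinearMap.adjoint ((WL2.linearEquiv ℂ ℂ (fun _ : TSite d m => c₁)).symm.toLinearMap ∘ₗ QprimeW L m φ U (c₀ := c₀))) ψ⟫_ℂ := by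
  have hc₀ : 0 < c₀ := Fact.out
  have hc₁ : 0 < c₁ := Fact.out
  have hL0 : (0 : ℝ) < L := by exact_mod_cast Nat.pos_of_ne_zero (NeZero.ne L)
  -- letters
  set Q : SiteL2K ℂ d (fineP L m) c₀ W →ₗ[ℂ] SiteL2K ℂ d m c₁ W :=
    (WL2.linearEquiv ℂ ℂ (fun _ : TSite d m => c₁)).symm.toLinearMap ∘ₗ QprimeW L m φ U (c₀ := c₀) with hQ
  set Q₁ : SiteL2K ℂ d (fineP L m) c₀ W →ₗ[ℂ] SiteL2K ℂ d m c₁ W :=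
    (WL2.linearEquiv ℂ ℂ (fun _ : TSite d m => c₁)).symm.toLinearMap ∘ₗ QprimeW L m φ (fun _ : Bond d (fineP L m) => (1 : 𝔸ˣ)) (c₀ := c₀)
    with hQ₁
  set T := laplacePrimeA L m φ η U a' (c₀ := c₀) (c₁ := c₁) with hT
  have hTs : T.IsSymmetric := laplacePrimeA_isSymmetric L m φ c₀ η U c₁ a' hRS
  set cL : ℝ := (L : ℝ) / 2 with hcL
  set β : ℝ := (((L : ℝ) ^ 2 + 2) / 6) ^ d with hβ
  set Bs : ℝ := ((L : ℝ) / 2 + (L : ℝ) ^ 2 / 4) ^ d with hBs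
  set Φ : ℝ := (d : ℝ) * ((L : ℝ) * ((L : ℝ) ^ 2 + 2) / 3) * ((L : ℝ) * (2 * (L : ℝ) ^ 4 + 5 * (L : ℝ) ^ 2 + 8) / 60) ^ (d - 1) with hΦ
  set ρw : ℝ := c₀ * (L : ℝ) ^ d / c₁ with hρw
  set E : ℝ := ‖((η : ℂ))⁻¹‖ ^ 2 * Φ * (c₀ / c₁) with hE
  set εR : ℝ := 2 * Mφ * Mφ' * ε with hεR
  set ρ' : ℝ := (1 + εR) ^ (d * (L - 1)) - 1 with hρ'
  set E' : ℝ := ‖((η : ℂ))⁻¹‖ ^ 2 * εR ^ 2 * (d : ℝ) * Bs ^ 2 * ρw with hE'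
  set M : ℝ := (1 + t) * E + (1 + t⁻¹) * E' + a' * (β + ρ' * Bs) ^ 2 with hM
  have hcL0 : 0 < cL := by rw [hcL]; positivity
  have hβS : ((L : ℝ) ^ d)⁻¹ * (∑ k ∈ Finset.range L, (cL + (k : ℝ) * ((L : ℝ) - 1 - k))) ^ d = β := by
    rw [sum_pedestal_eq, hcL, hβ, ← inv_pow, ← mul_pow]
    congr 1
    field_simp
    ring
  have hβ0 : 0 < β := by rw [hβ]; positivity
  have hBs0 : 0 ≤ Bs := by rw [hBs]; positivity
  have hΦ0 : 0 ≤ Φ := by rw [hΦ]; positivity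
  have hρw0 : 0 < ρw := by rw [hρw]; positivity
  have hεR0 : 0 ≤ εR := by rw [hεR]; positivity
  have hρ'0 : 0 ≤ ρ' := by rw [hρ']; exact sub_nonneg.2 (one_le_pow₀ (by linarith))
  have hE0 : 0 ≤ E := by rw [hE]; positivity
  have hE'0 : 0 ≤ E' := by rw [hE']; positivity
  have hM0 : 0 < M := by rw [hM]; positivity
  have hwin' : ρ' * Bs ≤ θ * β := hwin
  have ht1 : 0 < 1 + t⁻¹ := by positivity
  -- the test vector
  set ψt := WL2.equiv ℂ (fun _ : TSite d m => c₁) W ψ with hψt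
  set u : SiteL2K ℂ d (fineP L m) c₀ W := (WL2.equiv ℂ (fun _ : TSite d (fineP L m) => c₀) W).symm
    (fun x => (((∏ ν, (cL + ((offset L m x ν : ℕ) : ℝ) * ((L : ℝ) - 1 - (offset L m x ν : ℕ)))) : ℝ) : ℂ) • ψt (blockCoord L m x)) with hu
  have hQ₁u : Q₁ u = ((β : ℝ) : ℂ) • ψ := by
    rw [← hβS]; exact QprimeWL2_one_lift L m φ c₀ c₁ _ (fun y => sum_blockOf_pedestal L m cL y) ψ
  have hun : ‖u‖ ^ 2 ≤ Bs ^ 2 * ρw * ‖ψ‖ ^ 2 := by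
    have h := norm_sq_lift_le L m c₀ c₁ (fun x => ∏ ν, (cL + ((offset L m x ν : ℕ) : ℝ) * ((L : ℝ) - 1 - (offset L m x ν : ℕ))))
      (abs_pedestal_le' L m hcL0.le) ψ
    have e : (cL + (L : ℝ) ^ 2 / 4) ^ d = Bs := by rw [hBs, hcL]
    rw [e] at h
    rw [hρw]; exact h
  have hun' : ‖u‖ ≤ Bs * Real.sqrt ρw * ‖ψ‖ := by
    have h2 : (Bs * Real.sqrt ρw * ‖ψ‖) ^ 2 = Bs ^ 2 * ρw * ‖ψ‖ ^ 2 := by rw [mul_pow, mul_pow, Real.sq_sqrt hρw0.le]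
    exact (pow_le_pow_iff_left₀ (norm_nonneg _) (by positivity) two_ne_zero).1 (h2 ▸ hun)
  -- the transporter letter and the averaging letter
  have hR : ∀ (b : Bond d (fineP L m)) (w : W), ‖adTransportW φ U b w - w‖ ≤ εR * ‖w‖ := fun b w => by
    rw [hεR]; exact norm_adTransportW_sub_le φ hφ hφ' hMφ' U b (hU b) (hUε b) w
  have hδ : ‖Q u - Q₁ u‖ ≤ ρ' * Bs * ‖ψ‖ := by
    -- `‖Q̃′(U)u − Q̃′(1)u‖²_{c₁} = c₁ Σ_y ‖…‖² ≤ ρ′²·(c₁∕(L^d c₀))·‖u‖² ≤ (ρ′ B_s ‖ψ‖)²`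
    have h1 := sum_norm_sq_QprimeW_sub_flat_le L m φ U hεR0 hR u
    have h2 : ‖Q u - Q₁ u‖ ^ 2 = c₁ * ∑ y, ‖QprimeW L m φ U (c₀ := c₀) u y - QprimeW L m φ (fun _ => 1) (c₀ := c₀) u y‖ ^ 2 := by
      rw [WL2.norm_sq, Finset.mul_sum]; rfl
    have h3 : ‖Q u - Q₁ u‖ ^ 2 ≤ (ρ' * Bs * ‖ψ‖) ^ 2 := by
      rw [h2]
      calc c₁ * ∑ y, ‖QprimeW L m φ U (c₀ := c₀) u y - QprimeW L m φ (fun _ => 1) (c₀ := c₀) u y‖ ^ 2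
          ≤ c₁ * (ρ' ^ 2 * (((L : ℝ) ^ d * c₀)⁻¹ * ‖u‖ ^ 2)) := mul_le_mul_of_nonneg_left h1 hc₁.le
        _ ≤ c₁ * (ρ' ^ 2 * (((L : ℝ) ^ d * c₀)⁻¹ * (Bs ^ 2 * ρw * ‖ψ‖ ^ 2))) := by gcongr
        _ = (ρ' * Bs * ‖ψ‖) ^ 2 := by rw [hρw]; field_simp
    exact (pow_le_pow_iff_left₀ (norm_nonneg _) (by positivity) two_ne_zero).1 h3
  have hQu : Q u = ((β : ℝ) : ℂ) • ψ + (Q u - Q₁ u) := by rw [hQ₁u]; abel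
  -- (1) `(1−θ)β‖ψ‖² ≤ re⟪u, Q†ψ⟫`
  have hux : (1 - θ) * β * ‖ψ‖ ^ 2 ≤ RCLike.re ⟪u, LinearMap.adjoint Q ψ⟫_ℂ := by
    rw [LinearMap.adjoint_inner_right, hQu, inner_add_left, map_add, inner_smul_left, Complex.conj_ofReal]
    have e1 : RCLike.re ((β : ℂ) * ⟪ψ, ψ⟫_ℂ) = β * ‖ψ‖ ^ 2 := by
      rw [← inner_self_eq_norm_sq (𝕜 := ℂ) ψ]; simp only [RCLike.re_to_complex, Complex.re_ofReal_mul]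
    rw [e1]
    have e2 : |RCLike.re ⟪Q u - Q₁ u, ψ⟫_ℂ| ≤ ρ' * Bs * ‖ψ‖ * ‖ψ‖ :=
      (RCLike.abs_re_le_norm _).trans ((norm_inner_le_norm _ _).trans (mul_le_mul_of_nonneg_right hδ (norm_nonneg _)))
    have e3 := neg_le_of_abs_le e2
    have h5 : ρ' * Bs * ‖ψ‖ * ‖ψ‖ ≤ θ * β * ‖ψ‖ ^ 2 := by
      rw [mul_assoc (ρ' * Bs), ← pow_two]; exact mul_le_mul_of_nonneg_right hwin' (sq_nonneg _)
    linarith [e3, h5]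
  -- (2) `re⟪u, Tu⟫ ≤ M‖ψ‖²`
  have huu : RCLike.re ⟪u, T u⟫_ℂ ≤ M * ‖ψ‖ ^ 2 := by
    rw [hT, re_inner_laplacePrimeA L m φ c₀ η c₁ a' U hRS u]
    -- Dirichlet part at the flat background: the pedestal's EXACT block sums (leaf-01's split step bound)
    have hD1' : ‖covDerivL2K ℂ c₀ ((η : ℂ))⁻¹ (adTransportW φ (fun _ : Bond d (fineP L m) => (1 : 𝔸ˣ))) u‖ ^ 2 ≤ E * ‖ψ‖ ^ 2 := by
      have h := norm_sq_covDerivL2K_lift_le_split L m φ c₀ η c₁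
        (fun x => ∏ ν, (cL + ((offset L m x ν : ℕ) : ℝ) * ((L : ℝ) - 1 - (offset L m x ν : ℕ)))) ψ
        (fun μ x => (if offset L m x μ + 1 < L then ((L : ℝ) - 2 - 2 * (offset L m x μ : ℕ)) ^ 2 else 2 * cL ^ 2) *
          (∏ ν ∈ Finset.univ.erase μ, (cL + ((offset L m x ν : ℕ) : ℝ) * ((L : ℝ) - 1 - (offset L m x ν : ℕ)))) ^ 2)
        (fun μ x => (if offset L m x μ = 0 then 2 * cL ^ 2 else 0) *
          (∏ ν ∈ Finset.univ.erase μ, (cL + ((offset L m x ν : ℕ) : ℝ) * ((L : ℝ) - 1 - (offset L m x ν : ℕ)))) ^ 2)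
        (Φ := Φ) (fun x μ => pedestal_step_le L m cL ψt x μ)
        (fun y => by
          rw [sum_blockOf_pedestal_weights L m cL y, sum_pedestal_sq_eq, hΦ, hcL]
          exact le_of_eq (by ring))
      rw [hE]; exact h
    have hdiff := norm_covDerivL2K_sub_le (𝕜 := ℂ) (c₀ := c₀) (c := ((η : ℂ))⁻¹) (R := adTransportW φ U)
      (R₁ := adTransportW φ (fun _ : Bond d (fineP L m) => (1 : 𝔸ˣ))) hεR0 hR (adTransportW_one_apply L m φ) u
    have hDU : ‖covDerivL2K ℂ c₀ ((η : ℂ))⁻¹ (adTransportW φ U) u‖ ≤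
        ‖covDerivL2K ℂ c₀ ((η : ℂ))⁻¹ (adTransportW φ (fun _ : Bond d (fineP L m) => (1 : 𝔸ˣ))) u‖ + ‖((η : ℂ))⁻¹‖ * εR * Real.sqrt d * ‖u‖ :=
      (norm_le_insert' _ _).trans (add_le_add le_rfl hdiff)
    -- `‖D_1 u‖ ≤ √E‖ψ‖`, `‖u‖ ≤ B_s√ρw‖ψ‖`
    have ha₁ : ‖covDerivL2K ℂ c₀ ((η : ℂ))⁻¹ (adTransportW φ (fun _ : Bond d (fineP L m) => (1 : 𝔸ˣ))) u‖ ≤ Real.sqrt E * ‖ψ‖ := by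
      have h2 : (Real.sqrt E * ‖ψ‖) ^ 2 = E * ‖ψ‖ ^ 2 := by rw [mul_pow, Real.sq_sqrt hE0]
      exact (pow_le_pow_iff_left₀ (norm_nonneg _) (by positivity) two_ne_zero).1 (h2 ▸ hD1')
    have ha₂ : ‖((η : ℂ))⁻¹‖ * εR * Real.sqrt d * ‖u‖ ≤ ‖((η : ℂ))⁻¹‖ * εR * Real.sqrt d * (Bs * Real.sqrt ρw * ‖ψ‖) :=
      mul_le_mul_of_nonneg_left hun' (by positivity)
    have hDU' : ‖covDerivL2K ℂ c₀ ((η : ℂ))⁻¹ (adTransportW φ U) u‖ ≤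
        (Real.sqrt E + ‖((η : ℂ))⁻¹‖ * εR * Real.sqrt d * Bs * Real.sqrt ρw) * ‖ψ‖ := by
      refine hDU.trans ?_
      have := add_le_add ha₁ ha₂
      refine this.trans (le_of_eq ?_)
      ring
    have hsq : ‖covDerivL2K ℂ c₀ ((η : ℂ))⁻¹ (adTransportW φ U) u‖ ^ 2 ≤ ((1 + t) * E + (1 + t⁻¹) * E') * ‖ψ‖ ^ 2 := by
      have h1 : ‖covDerivL2K ℂ c₀ ((η : ℂ))⁻¹ (adTransportW φ U) u‖ ^ 2 ≤
          ((Real.sqrt E + ‖((η : ℂ))⁻¹‖ * εR * Real.sqrt d * Bs * Real.sqrt ρw) * ‖ψ‖) ^ 2 :=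
        pow_le_pow_left₀ (norm_nonneg _) hDU' 2
      refine h1.trans ?_
      have hd0 : (0 : ℝ) ≤ d := Nat.cast_nonneg d
      -- `(a + b)² ≤ 2a² + 2b²`, `(√E)² = E`, `(√d)² = d`, `(√ρw)² = ρw`
      have e1 : ((Real.sqrt E + ‖((η : ℂ))⁻¹‖ * εR * Real.sqrt d * Bs * Real.sqrt ρw) * ‖ψ‖) ^ 2 ≤
          ((1 + t) * (Real.sqrt E) ^ 2 + (1 + t⁻¹) * (‖((η : ℂ))⁻¹‖ * εR * Real.sqrt d * Bs * Real.sqrt ρw) ^ 2) * ‖ψ‖ ^ 2 := by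
        rw [mul_pow]
        exact mul_le_mul_of_nonneg_right (add_sq_le_weighted' ht _ _) (sq_nonneg _)
      refine e1.trans (le_of_eq ?_)
      rw [Real.sq_sqrt hE0, mul_pow, mul_pow, mul_pow, mul_pow, Real.sq_sqrt hd0, Real.sq_sqrt hρw0.le, hE']
    -- averaging part: `‖Q u‖ ≤ (β + ρ′B_s)‖ψ‖`
    have hQn : ‖Q u‖ ≤ (β + ρ' * Bs) * ‖ψ‖ := by
      rw [hQu]
      refine (norm_add_le _ _).trans ?_
      rw [norm_smul, Complex.norm_real, Real.norm_eq_abs, abs_of_pos hβ0, add_mul]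
      exact add_le_add le_rfl hδ
    have hQsq : a' * ‖Q u‖ ^ 2 ≤ a' * ((β + ρ' * Bs) ^ 2 * ‖ψ‖ ^ 2) := by
      refine mul_le_mul_of_nonneg_left ?_ ha'.le
      rw [← mul_pow]; exact pow_le_pow_left₀ (norm_nonneg _) hQn 2
    rw [← hQ]
    calc _ ≤ ((1 + t) * E + (1 + t⁻¹) * E') * ‖ψ‖ ^ 2 + a' * ((β + ρ' * Bs) ^ 2 * ‖ψ‖ ^ 2) := add_le_add hsq hQsq
      _ = M * ‖ψ‖ ^ 2 := by rw [hM]; ring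
  -- (3) the first-order variational principle: `κ₁‖ψ‖² ≤ re⟪Q†ψ, G′(U)Q†ψ⟫`, `κ₁ = (β∕2)²∕M`
  have hG : ∀ z, GpOfU L m φ η U a' (c₁ := c₁) hpos' z = greenK T hpos' z := fun z => rfl
  have hθβ : (0 : ℝ) ≤ (1 - θ) * β := mul_nonneg (by linarith) hβ0.le
  have hκ₁ := sq_div_mul_le_re_inner_green hTs hpos' hM0 hθβ hux huu
  -- (4) Cauchy–Schwarz with `‖Q̃′(U)‖ ≤ N := (1 + ρ′)√(c₁∕(c₀L^d))`
  have hN0 : 0 < (1 + ρ') * Real.sqrt (c₁ / (c₀ * (L : ℝ) ^ d)) := by positivity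
  have hQv : ∀ v, ‖Q v‖ ≤ (1 + ρ') * Real.sqrt (c₁ / (c₀ * (L : ℝ) ^ d)) * ‖v‖ := fun v => by
    have h1 : ‖Q₁ v‖ ≤ Real.sqrt (c₁ / (c₀ * (L : ℝ) ^ d)) * ‖v‖ := by
      have h := norm_sq_QprimeWL2_one_le L m φ c₀ c₁ v
      rw [← hQ₁] at h
      refine (pow_le_pow_iff_left₀ (norm_nonneg _) (by positivity) two_ne_zero).1 ?_
      rw [mul_pow, Real.sq_sqrt (by positivity)]
      exact h
    have h2 : ‖Q v - Q₁ v‖ ≤ ρ' * Real.sqrt (c₁ / (c₀ * (L : ℝ) ^ d)) * ‖v‖ := by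
      have hs := sum_norm_sq_QprimeW_sub_flat_le L m φ U hεR0 hR v
      have h3 : ‖Q v - Q₁ v‖ ^ 2 = c₁ * ∑ y, ‖QprimeW L m φ U (c₀ := c₀) v y - QprimeW L m φ (fun _ => 1) (c₀ := c₀) v y‖ ^ 2 := by
        rw [WL2.norm_sq, Finset.mul_sum]; rfl
      have h4 : ‖Q v - Q₁ v‖ ^ 2 ≤ (ρ' * Real.sqrt (c₁ / (c₀ * (L : ℝ) ^ d)) * ‖v‖) ^ 2 := by
        rw [h3, mul_pow, mul_pow, Real.sq_sqrt (by positivity)]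
        calc c₁ * ∑ y, ‖QprimeW L m φ U (c₀ := c₀) v y - QprimeW L m φ (fun _ => 1) (c₀ := c₀) v y‖ ^ 2
            ≤ c₁ * (ρ' ^ 2 * (((L : ℝ) ^ d * c₀)⁻¹ * ‖v‖ ^ 2)) := mul_le_mul_of_nonneg_left hs hc₁.le
          _ = ρ' ^ 2 * (c₁ / (c₀ * (L : ℝ) ^ d)) * ‖v‖ ^ 2 := by field_simp
      exact (pow_le_pow_iff_left₀ (norm_nonneg _) (by positivity) two_ne_zero).1 h4
    calc ‖Q v‖ ≤ ‖Q₁ v‖ + ‖Q v - Q₁ v‖ := norm_le_insert' _ _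
      _ ≤ Real.sqrt (c₁ / (c₀ * (L : ℝ) ^ d)) * ‖v‖ + ρ' * Real.sqrt (c₁ / (c₀ * (L : ℝ) ^ d)) * ‖v‖ := add_le_add h1 h2
      _ = (1 + ρ') * Real.sqrt (c₁ / (c₀ * (L : ℝ) ^ d)) * ‖v‖ := by ring
  have hfin := sq_mul_norm_sq_le_re_inner_qggq hTs hpos' Q hN0 (div_nonneg (sq_nonneg _) hM0.le) hQv ψ hκ₁
  -- (5) the constant
  have hconst : (((1 - θ) * β) ^ 2 / M / ((1 + ρ') * Real.sqrt (c₁ / (c₀ * (L : ℝ) ^ d)))) ^ 2 =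
      (((1 - θ) * β) ^ 2 / M) ^ 2 * (c₀ * (L : ℝ) ^ d / c₁) / (1 + ρ') ^ 2 := by
    rw [div_pow, mul_pow (1 + ρ'), Real.sq_sqrt (by positivity)]
    field_simp
  rw [hconst, hM, hE, hE', hΦ, hBs, hρw, hρ', hεR] at hfin
  simpa only [LinearMap.comp_apply, hG] using hfin

end Window

end Literature.MathematicalPhysics.QuantumFieldTheory.Balaban1983to89.B9Eq365QGGQLowerVariationalWindowSharp

end
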